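import Literature.NumberTheory.Automorphic.ReciprocityGLn
import HarnessLib

/-!
# Gap transport: a Satake gap gives a gap between the arithmetic-Frobenius eigenvalues

Helper file for the crux `GaloisRepOfRegularAlgebraic` (stmt-Langlands-10785), line `Sketch`,
stub `stub_gapTransport` (S4, the dictionary step).  If `q > 0`, `0 ∉ α` and no two elements of
the Satake multiset `α` are in ratio `q`, then no two roots of `arithFrobPolyOfSatake ι q n α`
(the numbers `ι⁻¹((c a)⁻¹)`, `a ∈ α`, `c = (√q)^{n-1}`, by `roots_arithFrobPolyOfSatake`) are in
ratio `q`: applying the ring isomorphism `ι` to `ι⁻¹((c a)⁻¹) = q ι⁻¹((c b)⁻¹)` and clearing the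
non-zero scalars gives `b = q a`.  Mathlib plus the accepted `ReciprocityGLn` API only.
-/

noncomputable section

set_option linter.dupNamespace false -- project-wide option (lakefile weak.linter.dupNamespace); `Summit.Langlands.Langlands` is the mandated namespace

open Polynomial Literature.NumberTheory.Automorphic

namespace Summit.Langlands.Langlands.Theorems.GaloisRepOfRegularAlgebraic

/-- **Gap transport.**  For `q > 0`, `0 ∉ α` and `a ≠ q b` for all `a, b ∈ α`, no two roots of
`arithFrobPolyOfSatake ι q n α` are in ratio `q`: the roots are the `ι⁻¹((c a)⁻¹)`, `a ∈ α`,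
with `c = (√q)^{n-1} ≠ 0`, and `(c a)⁻¹ = q (c b)⁻¹` forces `b = q a`. [folklore] -/
theorem stub_gapTransport :
    ∀ {ℓ : ℕ} [Fact ℓ.Prime] (ι : PadicAlgCl ℓ ≃+* ℂ) (q n : ℕ), 0 < q →
      ∀ (α : Multiset ℂ), (0 : ℂ) ∉ α → (∀ a ∈ α, ∀ b ∈ α, a ≠ (q : ℂ) * b) →
      ∀ a ∈ (arithFrobPolyOfSatake ι q n α).roots, ∀ b ∈ (arithFrobPolyOfSatake ι q n α).roots,
        a ≠ (q : PadicAlgCl ℓ) * b := by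
  intro ℓ _ ι q n hq α h0 hgap a ha b hb hab
  rw [roots_arithFrobPolyOfSatake, Multiset.mem_map] at ha hb
  obtain ⟨a₀, ha₀, rfl⟩ := ha
  obtain ⟨b₀, hb₀, rfl⟩ := hb
  set c : ℂ := ((Real.sqrt q : ℝ) : ℂ) ^ (n - 1) with hc_def
  have hc : c ≠ 0 := by
    refine pow_ne_zero _ ?_
    rw [Ne, Complex.ofReal_eq_zero]
    exact (Real.sqrt_pos.mpr (by exact_mod_cast hq)).ne'
  have ha0 : a₀ ≠ 0 := fun h ↦ h0 (h ▸ ha₀)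
  have hb0 : b₀ ≠ 0 := fun h ↦ h0 (h ▸ hb₀)
  have hca : c * a₀ ≠ 0 := mul_ne_zero hc ha0
  have hcb : c * b₀ ≠ 0 := mul_ne_zero hc hb0
  -- apply `ι` to `hab : ι⁻¹((c a₀)⁻¹) = q ι⁻¹((c b₀)⁻¹)`
  have key : (c * a₀)⁻¹ = (q : ℂ) * (c * b₀)⁻¹ := by
    have h := congrArg ι hab
    simp only [map_mul, map_natCast, RingEquiv.apply_symm_apply] at h
    exact h
  -- clear the denominators: `c b₀ = q (c a₀)`
  have key' : c * b₀ = (q : ℂ) * (c * a₀) := by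
    calc c * b₀ = (c * a₀) * (c * a₀)⁻¹ * (c * b₀) := by rw [mul_inv_cancel₀ hca, one_mul]
      _ = (c * a₀) * ((q : ℂ) * (c * b₀)⁻¹) * (c * b₀) := by rw [key]
      _ = (q : ℂ) * (c * a₀) * ((c * b₀)⁻¹ * (c * b₀)) := by ring
      _ = (q : ℂ) * (c * a₀) := by rw [inv_mul_cancel₀ hcb, mul_one]
  -- cancel `c`: `b₀ = q a₀`, contradicting the Satake gap at the pair `(b₀, a₀)`
  have hfin : b₀ = (q : ℂ) * a₀ := by
    refine mul_left_cancel₀ hc ?_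
    calc c * b₀ = (q : ℂ) * (c * a₀) := key'
      _ = c * ((q : ℂ) * a₀) := by ring
  exact hgap b₀ hb₀ a₀ ha₀ hfin

end Summit.Langlands.Langlands.Theorems.GaloisRepOfRegularAlgebraic

end
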